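import Summits.BirchSwinnertonDyer.Rank1Residual.X2.GreenbergVatsalProPrimeToP
import Literature.NumberTheory.EllipticCurves.IwasawaCoinvariantsRankProofs
import HarnessLib

/-!
# Cocycles of `ker κ ∩ D_v` vanishing on inertia are coboundaries: `H¹` of a "pro-prime-to-`p`"
# quotient with `p`-primary coefficients vanishes (GV p. 17, cohomological form)

HONEST FRAMING (cell `b2b-bsdres`, run/shared/lean/b2b/bsd-rank1-residual/, verbatim in every
file): the goal of the cell is to DELETE the COMBINATION-SHAPED residual classes of the
Birch–Swinnerton-Dyer formula for ALL analytic-rank `≤ 1` elliptic curves over `ℚ` — "full BSD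
formula for every rank `≤ 1` curve in class `C`" assembled STRICTLY from published theorems — so
that the rank-`≤ 1` remainder becomes exactly the CONSTRUCTION-SHAPED classes, which are TYPED
(missing-input `Prop`s), NOT attempted. This is not "finishing BSD". Sub-cell
`b2b-bsdres-eisenstein-p2` (CLASS-OWNERS row "X2"), gen 10: research route; NO CLAIM BEYOND STATED
CLASSES; nothing here changes a label. THEOREMS ONLY (no `def`, no named fact, nothing asserted).

WHAT. In the Frobenius set-up of `GreenbergVatsalProPrimeToP` (`Γ` profinite, `I ≤ G`, `φ`, `κ`),
let `M` be a discrete `p`-primary torsion `Γ`-module with continuous orbit maps and finite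
`p^k`-torsion for every `k`, on which `I` acts trivially, and `P = ker κ ∩ G` (closed). Then every
continuous `1`-cocycle `g : P → M` vanishing on `I` is a coboundary
(`exists_eq_smul_sub_of_vanishing_on_inertia`). This is `H¹(P/I, M) = 0` for the pro-prime-to-`p`
group `P/I` — Greenberg–Vatsal, §2 p. 17: "`G_η/I_η` has profinite order prime to `p`. So the last
condition is equivalent to `[σ|_{I_η}] = 0`" — proved in finite terms:
(1) the values of `g` lie in the finite `Γ`-stable set `T = M[p^N]`, whose fixator `U₀` is an open
normal subgroup containing `I`; on `P ∩ U₀` the cocycle is a homomorphism, killed both by `p^N` and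
by the prime-to-`p` exponent `m'` of `GreenbergVatsalProPrimeToP.exists_coprime_pow_mem_modSubgroup`
(for an open normal `U₁ ⊆ U₀` inside the zero set of `g`), hence ZERO there;
(2) `G/((U₀·I) ∩ G) = ⟨φ̄⟩` is cyclic, so the image of `P` is cyclic with a generator `σ̄₀`,
`σ₀ ∈ P`, of order dividing the prime-to-`p` exponent `m₀'`; then
`b = -a · Σ_{i<m₀'} g(σ₀^i)` with `m₀' a + p^N b' = 1` satisfies `g(σ₀) = σ₀ b - b`, and `g - ∂b`
vanishes at `σ₀` and on `P ∩ U₀`, hence on `P = ⋃ σ₀^k (P ∩ U₀)`.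
Pure topological group cohomology in the style of the tree's `ResKernel` files
(`IwasawaCoinvariantsRankProofs`: `zeroSubgroup`, `exists_uniform_pow_smul_eq_zero`; `cobCocycle`).

References: Greenberg–Vatsal (2000) §2 p. 17; Serre, *Galois Cohomology*, I.§2, I.§5.
-/

noncomputable section

open scoped Classical Pointwise

universe u

namespace Summit.BirchSwinnertonDyer.Rank1Residual.X2.GreenbergVatsalProPrimeToPCocycle

open Literature.NumberTheory.GaloisRepresentations Literature.NumberTheory.EllipticCurves
  Literature.NumberTheory.EllipticCurves.ResKernel
  Summit.BirchSwinnertonDyer.Rank1Residual.X2.GreenbergVatsalProPrimeToP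

/-! ## §3. Cocycles on `ker κ ∩ G` vanishing on `I` are coboundaries -/

section Cocycle

variable {Γ : Type u} [Group Γ] [TopologicalSpace Γ] [IsTopologicalGroup Γ] [CompactSpace Γ]
  [TotallyDisconnectedSpace Γ]
variable {M : Type u} [AddCommGroup M] [DistribMulAction Γ M] [TopologicalSpace M]
  [DiscreteTopology M]
variable {p : ℕ} [Fact p.Prime]
variable {G I : Subgroup Γ} {φ : Γ} {κ : Γ →* Multiplicative ℤ_[p]}

omit [TopologicalSpace Γ] [IsTopologicalGroup Γ] [CompactSpace Γ] [TotallyDisconnectedSpace Γ]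
  [TopologicalSpace M] [DiscreteTopology M] [Fact p.Prime] in
/-- Powers of an element fixing `m` fix `m`. [folklore] -/
theorem pow_smul_eq_of_smul_eq {x : Γ} {m : M} (hx : x • m = m) (k : ℕ) : x ^ k • m = m := by
  induction k with
  | zero => rw [pow_zero, one_smul]
  | succ k ih => rw [pow_succ, mul_smul, hx, ih]

omit [IsTopologicalGroup Γ] [CompactSpace Γ] [TotallyDisconnectedSpace Γ] [Fact p.Prime] in
/-- A cocycle on a subgroup `P` is additive in an element fixing all its values:
`g(x^k) = k • g(x)`. [folklore] -/
theorem cocycle_pow_of_fix {P : Subgroup Γ} (g : contOneCocycles (discreteTopRep P M)) (x : P)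
    (hx : ∀ y : P, (x : Γ) • g.1 y = g.1 y) (k : ℕ) : g.1 (x ^ k) = k • g.1 x := by
  induction k with
  | zero => rw [pow_zero, contOneCocycles.apply_one, zero_smul]
  | succ k ih =>
    rw [pow_succ, g.2, discreteTopRep_ρ_apply, ih, Subgroup.smul_def, SubgroupClass.coe_pow,
      pow_smul_eq_of_smul_eq (hx x), add_smul, one_smul]

omit [TopologicalSpace Γ] [IsTopologicalGroup Γ] [CompactSpace Γ] [TotallyDisconnectedSpace Γ]
  [DistribMulAction Γ M] [TopologicalSpace M] [DiscreteTopology M] [Fact p.Prime] in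
/-- An element killed by two coprime naturals is zero. [folklore] -/
theorem eq_zero_of_coprime_nsmul {m : M} {a b : ℕ} (hab : Nat.Coprime a b) (ha : a • m = 0)
    (hb : b • m = 0) : m = 0 := by
  have h1 : addOrderOf m ∣ 1 := by
    rw [← hab]
    exact Nat.dvd_gcd (addOrderOf_dvd_of_nsmul_eq_zero ha) (addOrderOf_dvd_of_nsmul_eq_zero hb)
  exact AddMonoid.addOrderOf_eq_one_iff.mp (Nat.dvd_one.mp h1)

omit [IsTopologicalGroup Γ] [CompactSpace Γ] [TotallyDisconnectedSpace Γ] [Fact p.Prime] in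
/-- Stabilisers of points of a discrete module with continuous orbit maps are open. [folklore] -/
theorem isOpen_stabilizer_of_continuous (hcont : ∀ m : M, Continuous fun g : Γ ↦ g • m) (m : M) :
    IsOpen (MulAction.stabilizer Γ m : Set Γ) := by
  have : (MulAction.stabilizer Γ m : Set Γ) = (fun g : Γ ↦ g • m) ⁻¹' {m} := by
    ext g; simp [MulAction.mem_stabilizer_iff]
  rw [this]
  exact (isOpen_discrete {m}).preimage (hcont m)

/-- **Abstract "unramified ⇒ locally trivial" over a `ℤ_p`-tower.** In the Frobenius set-up of
`exists_coprime_pow_mem_modSubgroup` (`G ⊇ I` decomposition and inertia groups inside a profinite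
`Γ`, `φ ∈ G` a Frobenius, `κ : Γ → ℤ_p` with `κ(I) = 1`, `κ φ ≠ 1`), let `M` be a discrete
`p`-primary torsion `Γ`-module with continuous orbit maps and finite `p^k`-torsion for every `k`,
on which `I` acts trivially, and `P = ker κ ∩ G` (closed; the decomposition group of the
`ℤ_p`-tower `K_∞` at the place). Then every continuous `1`-cocycle of `P` with values in `M` which vanishes on `I` is a
coboundary: `H¹(P/I, M) = 0` because `P/I` is "pro-prime-to-`p`" — in finite terms, the image of
`P` in each `G/(U·I ∩ G) = ⟨φ̄⟩` has order prime to `p` (`exists_coprime_pow_mem_modSubgroup`), so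
(1) on `P ∩ U₀` (`U₀` the fixator of `M[p^N] ∋` all values) the cocycle is a homomorphism killed by
a prime-to-`p` exponent and by `p^N`, hence zero, and (2) on the finite cyclic image a cocycle is
the coboundary of `-(1/d)·Σ_{i<d} g(σ₀^i)` (`d` prime to `p`). GV, p. 17: "`G_η/I_η` has profinite
order prime to `p`. So the last condition is equivalent to `[σ|_{I_η}] = 0`".
[cite: GreenbergVatsal2000, §2 p. 17] -/
theorem exists_eq_smul_sub_of_vanishing_on_inertia (hIG : I ≤ G)
    (hIn : ∀ g ∈ G, ∀ i ∈ I, g * i * g⁻¹ ∈ I) (hφ : φ ∈ G)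
    (hdec : ∀ U : Subgroup Γ, IsOpen (U : Set Γ) → ∀ d ∈ G,
      ∃ (n : ℕ) (i u : Γ), i ∈ I ∧ u ∈ U ∧ d = φ ^ n * i * u)
    (hκI : ∀ i ∈ I, κ i = 1) (hκφ : κ φ ≠ 1)
    (hlayer : ∀ B : ℕ, ∃ V : Subgroup Γ, IsOpen (V : Set Γ) ∧
      ∀ v ∈ V, (p : ℤ_[p]) ^ B ∣ (κ v).toAdd)
    {P : Subgroup Γ} (hPmem : ∀ {x : Γ}, x ∈ P ↔ κ x = 1 ∧ x ∈ G) (hPc : IsClosed (P : Set Γ))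
    (hcont : ∀ m : M, Continuous fun g : Γ ↦ g • m)
    (htor : ∀ m : M, ∃ k : ℕ, p ^ k • m = 0) (hfin : ∀ k : ℕ, Set.Finite {m : M | p ^ k • m = 0})
    (hIM : ∀ i ∈ I, ∀ m : M, i • m = m)
    (g : contOneCocycles (discreteTopRep P M))
    (hg : ∀ x : P, (x : Γ) ∈ I → g.1 x = 0) :
    ∃ b : M, ∀ x : P, g.1 x = (x : Γ) • b - b := by
  -- finitely many values, all killed by `p^N`
  haveI : CompactSpace P := isCompact_iff_compactSpace.mp hPc.isCompact
  have hfinrange : (Set.range g.1).Finite := (isCompact_range g.1.continuous).finite_of_discrete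
  obtain ⟨N, hN⟩ := exists_uniform_pow_smul_eq_zero p (Set.range g.1) hfinrange
    (fun s hs ↦ by obtain ⟨x, rfl⟩ := hs; exact htor _)
  have hgN : ∀ x, p ^ N • g.1 x = 0 := fun x ↦ hN _ ⟨x, rfl⟩
  -- `U₀` = the fixator of `T = M[p^N]`, an open normal subgroup containing `I`
  set T : Set M := {m | p ^ N • m = 0} with hT
  have hTfin : T.Finite := hfin N
  set U₀ : Subgroup Γ := ⨅ (m : M) (_ : m ∈ T), MulAction.stabilizer Γ m with hU₀
  have hU₀mem : ∀ σ : Γ, σ ∈ U₀ ↔ ∀ m ∈ T, σ • m = m := by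
    intro σ; simp only [hU₀, Subgroup.mem_iInf, MulAction.mem_stabilizer_iff]
  have hU₀open : IsOpen (U₀ : Set Γ) := by
    have e : (U₀ : Set Γ) = ⋂ m ∈ T, (MulAction.stabilizer Γ m : Set Γ) := by
      ext σ
      rw [SetLike.mem_coe, hU₀mem, Set.mem_iInter₂]
      simp only [SetLike.mem_coe, MulAction.mem_stabilizer_iff]
    rw [e]
    exact hTfin.isOpen_biInter fun m _ ↦ isOpen_stabilizer_of_continuous hcont m
  haveI hU₀n : U₀.Normal := by
    refine ⟨fun σ hσ τ ↦ (hU₀mem _).2 fun m hm ↦ ?_⟩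
    have hm' : τ⁻¹ • m ∈ T := by
      show p ^ N • τ⁻¹ • m = 0
      rw [smul_comm, show p ^ N • m = 0 from hm, smul_zero]
    rw [mul_smul, mul_smul, (hU₀mem σ).1 hσ _ hm', smul_inv_smul]
  have hIU₀ : I ≤ U₀ := fun i hi ↦ (hU₀mem i).2 fun m _ ↦ hIM i hi m
  have hTg : ∀ x, g.1 x ∈ T := hgN
  have hN₀U₀ : ∀ y, y ∈ (U₀ ⊔ I) ⊓ G → y ∈ U₀ := fun y hy ↦ by
    obtain ⟨⟨u, hu, i, hi, rfl⟩, -⟩ := (mem_modSubgroup_iff y).1 hy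
    exact U₀.mul_mem hu (hIU₀ hi)
  -- `U₁` = an open normal subgroup inside `U₀` and inside the zero set of `g`
  have hz : IsOpen {x : P | g.1 x = 0} := (isOpen_discrete ({0} : Set M)).preimage g.1.continuous
  obtain ⟨O, hO, hOeq⟩ := isOpen_induced_iff.mp hz
  have h1O : (1 : Γ) ∈ O := by
    have : (1 : P) ∈ Subtype.val ⁻¹' O := by rw [hOeq]; exact contOneCocycles.apply_one g
    exact this
  obtain ⟨U₁n, hU₁n⟩ := ProfiniteGrp.exist_openNormalSubgroup_sub_open_nhds_of_one
    (hO.inter hU₀open) ⟨h1O, U₀.one_mem⟩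
  set U₁ : Subgroup Γ := U₁n.toSubgroup with hU₁
  have hU₁open : IsOpen (U₁ : Set Γ) := U₁n.isOpen
  have hU₁zero : ∀ x : P, (x : Γ) ∈ U₁ → g.1 x = 0 := fun x hx ↦ by
    have h : x ∈ Subtype.val ⁻¹' O := (hU₁n hx).1
    rw [hOeq] at h
    exact h
  -- Claim 1: `g` vanishes on `P ∩ U₀`
  obtain ⟨m₁, -, hm₁cop, hm₁⟩ :=
    exists_coprime_pow_mem_modSubgroup hIG hIn hφ hdec hκI hκφ hlayer U₁ hU₁open
  have claim1 : ∀ x : P, (x : Γ) ∈ U₀ → g.1 x = 0 := by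
    intro x hxU₀
    obtain ⟨hκx, hxG⟩ := hPmem.1 x.2
    obtain ⟨⟨u, hu, i, hi, hui⟩, -⟩ := (mem_modSubgroup_iff _).1 (hm₁ x hxG hκx)
    have hiP : i ∈ P := hPmem.2 ⟨hκI i hi, hIG hi⟩
    have huP : u ∈ P := by
      have : u = (x : Γ) ^ m₁ * i⁻¹ := by rw [← hui]; group
      rw [this]; exact P.mul_mem (P.pow_mem x.2 _) (P.inv_mem hiP)
    have hval : g.1 (x ^ m₁) = g.1 ⟨u, huP⟩ + u • g.1 ⟨i, hiP⟩ := by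
      have e : x ^ m₁ = ⟨u, huP⟩ * ⟨i, hiP⟩ :=
        Subtype.ext (by simp only [SubgroupClass.coe_pow, Subgroup.coe_mul, hui])
      rw [e, g.2, discreteTopRep_ρ_apply]
      rfl
    rw [hg ⟨i, hiP⟩ hi, smul_zero, add_zero, hU₁zero ⟨u, huP⟩ hu] at hval
    have hfix : ∀ y : P, (x : Γ) • g.1 y = g.1 y := fun y ↦ (hU₀mem _).1 hxU₀ _ (hTg y)
    rw [cocycle_pow_of_fix g x hfix] at hval
    exact eq_zero_of_coprime_nsmul (Nat.Coprime.pow_right N hm₁cop) hval (hgN x)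
  -- Claim 2: the finite cyclic quotient `G / N_{U₀}` and a generator `σ₀` of the image of `P`
  obtain ⟨m₀, hm₀0, hm₀cop, hm₀⟩ :=
    exists_coprime_pow_mem_modSubgroup hIG hIn hφ hdec hκI hκφ hlayer U₀ hU₀open
  haveI hN₀n : (((U₀ ⊔ I) ⊓ G).subgroupOf G).Normal := modSubgroup_subgroupOf_normal hIn
  set Q₀ := G ⧸ ((U₀ ⊔ I) ⊓ G).subgroupOf G with hQ₀
  have hQeq : ∀ y z : G, (QuotientGroup.mk y : Q₀) = QuotientGroup.mk z ↔
      (y : Γ)⁻¹ * z ∈ (U₀ ⊔ I) ⊓ G := by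
    intro y z
    rw [QuotientGroup.eq, Subgroup.mem_subgroupOf, Subgroup.coe_mul, Subgroup.coe_inv]
  haveI : IsCyclic Q₀ := by
    refine ⟨⟨QuotientGroup.mk ⟨φ, hφ⟩, fun q ↦ ?_⟩⟩
    obtain ⟨d, rfl⟩ := QuotientGroup.mk_surjective q
    obtain ⟨n, i, u, hi, hu, hd⟩ := hdec U₀ hU₀open d d.2
    refine ⟨n, ?_⟩
    change (QuotientGroup.mk (⟨φ, hφ⟩ : G) : Q₀) ^ (n : ℤ) = QuotientGroup.mk d
    rw [zpow_natCast, ← QuotientGroup.mk_pow, hQeq]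
    have hiG : i ∈ G := hIG hi
    have huG : u ∈ G := by
      have : u = (φ ^ n * i)⁻¹ * d := by rw [hd]; group
      rw [this]
      exact G.mul_mem (G.inv_mem (G.mul_mem (G.pow_mem hφ _) hiG)) d.2
    have e : (φ ^ n)⁻¹ * (d : Γ) = i * u := by rw [hd]; group
    rw [SubgroupClass.coe_pow]
    change (φ ^ n)⁻¹ * (d : Γ) ∈ (U₀ ⊔ I) ⊓ G
    rw [e]
    refine (mem_modSubgroup_iff _).2 ⟨⟨i * u * i⁻¹, ?_, i, hi, by group⟩, G.mul_mem hiG huG⟩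
    exact Subgroup.Normal.conj_mem inferInstance u hu i
  set S : Subgroup Q₀ := (P.subgroupOf G).map (QuotientGroup.mk' _) with hS
  obtain ⟨s, hs⟩ := IsCyclic.exists_generator (α := S)
  obtain ⟨y, hyP, hys⟩ := Subgroup.mem_map.1 s.2
  rw [Subgroup.mem_subgroupOf] at hyP
  set σ₀ : P := ⟨y, hyP⟩ with hσ₀
  have hgen : ∀ x : P, ∃ (k : ℤ) (v : P), (v : Γ) ∈ U₀ ∧ x = σ₀ ^ k * v := by
    intro x
    have hxG : (x : Γ) ∈ G := (hPmem.1 x.2).2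
    have hxS : (QuotientGroup.mk (⟨x, hxG⟩ : G) : Q₀) ∈ S :=
      Subgroup.mem_map.2 ⟨⟨x, hxG⟩, (Subgroup.mem_subgroupOf).2 x.2, rfl⟩
    obtain ⟨k, hk⟩ := Subgroup.mem_zpowers_iff.1 (hs ⟨_, hxS⟩)
    have hk' : (QuotientGroup.mk (y ^ k) : Q₀) = QuotientGroup.mk ⟨(x : Γ), hxG⟩ := by
      have h := congrArg Subtype.val hk
      simp only [SubgroupClass.coe_zpow] at h
      rw [QuotientGroup.mk_zpow, ← h, ← hys]
      rfl
    rw [hQeq] at hk'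
    have hmemP : ((σ₀ : Γ) ^ k)⁻¹ * (x : Γ) ∈ P :=
      P.mul_mem (P.inv_mem (P.zpow_mem σ₀.2 k)) x.2
    refine ⟨k, ⟨((σ₀ : Γ) ^ k)⁻¹ * x, hmemP⟩, hN₀U₀ _ ?_, Subtype.ext ?_⟩
    · simpa only [hσ₀, SubgroupClass.coe_zpow] using hk'
    · simp only [Subgroup.coe_mul, SubgroupClass.coe_zpow]; group
  -- the coboundary: `b = -A • Σ_{i<m₀} g(σ₀^i)` with `m₀ A + p^N B = 1`
  have hσ₀D : ((σ₀ ^ m₀ : P) : Γ) ∈ U₀ := by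
    rw [SubgroupClass.coe_pow]
    exact hN₀U₀ _ (hm₀ _ (hPmem.1 σ₀.2).2 (hPmem.1 σ₀.2).1)
  have hbez : ((m₀ : ℤ) * Nat.gcdA m₀ (p ^ N)) + (p ^ N : ℕ) * Nat.gcdB m₀ (p ^ N) = 1 := by
    have h := Nat.gcd_eq_gcd_ab m₀ (p ^ N)
    rw [Nat.Coprime.gcd_eq_one (Nat.Coprime.pow_right N hm₀cop)] at h
    exact_mod_cast h.symm
  set A : ℤ := Nat.gcdA m₀ (p ^ N) with hA
  set B : ℤ := Nat.gcdB m₀ (p ^ N) with hB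
  set Sg : M := ∑ i ∈ Finset.range m₀, g.1 (σ₀ ^ i) with hSg
  set b : M := -(A • Sg) with hb
  have hSgT : p ^ N • Sg = 0 := by
    rw [hSg, Finset.smul_sum]
    exact Finset.sum_eq_zero fun i _ ↦ hgN _
  have hbT : b ∈ T := by
    show p ^ N • b = 0
    rw [hb, smul_neg, smul_comm, hSgT, smul_zero, neg_zero]
  -- `σ₀ • Σ = Σ - m₀ • g σ₀`
  have hSum : (σ₀ : Γ) • Sg = Sg - m₀ • g.1 σ₀ := by
    have hterm : ∀ i : ℕ, (σ₀ : Γ) • g.1 (σ₀ ^ i) = g.1 (σ₀ ^ (i + 1)) - g.1 σ₀ := fun i ↦ by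
      have h := g.2 σ₀ (σ₀ ^ i)
      rw [discreteTopRep_ρ_apply, ← pow_succ'] at h
      rw [h, Subgroup.smul_def, add_sub_cancel_left]
    rw [hSg, Finset.smul_sum]
    simp_rw [hterm]
    rw [Finset.sum_sub_distrib, Finset.sum_const, Finset.card_range]
    have h1 : ∑ i ∈ Finset.range m₀, g.1 (σ₀ ^ (i + 1)) =
        ∑ i ∈ Finset.range m₀, g.1 (σ₀ ^ i) := by
      have h := Finset.sum_range_succ' (fun i ↦ g.1 (σ₀ ^ i)) m₀
      rw [Finset.sum_range_succ, pow_zero, contOneCocycles.apply_one, add_zero,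
        claim1 _ hσ₀D, add_zero] at h
      exact h.symm
    rw [h1]
  -- `g σ₀ = σ₀ • b - b`
  have hgσ₀ : g.1 σ₀ = (σ₀ : Γ) • b - b := by
    have key : ((m₀ : ℤ) * A) • g.1 σ₀ = g.1 σ₀ := by
      have h1 : g.1 σ₀ = ((m₀ : ℤ) * A) • g.1 σ₀ + (((p ^ N : ℕ) : ℤ) * B) • g.1 σ₀ := by
        rw [← add_smul, hbez, one_smul]
      have h2 : (((p ^ N : ℕ) : ℤ) * B) • g.1 σ₀ = 0 := by
        rw [mul_comm, mul_smul, natCast_zsmul, hgN, smul_zero]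
      rw [h2, add_zero] at h1
      exact h1.symm
    calc g.1 σ₀ = ((m₀ : ℤ) * A) • g.1 σ₀ := key.symm
      _ = A • ((m₀ : ℕ) • g.1 σ₀) := by rw [mul_comm, mul_smul, natCast_zsmul]
      _ = (σ₀ : Γ) • b - b := by
        rw [hb, smul_neg, smul_comm (σ₀ : Γ) A Sg, hSum, smul_sub, neg_sub', sub_neg_eq_add]
        abel
  -- `g - ∂b` vanishes at `σ₀` and on `P ∩ U₀`, hence everywhere
  set cb : contOneCocycles (discreteTopRep P M) :=
    cobCocycle b ((hcont b).comp continuous_subtype_val) with hcb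
  have hcb_apply : ∀ x : P, cb.1 x = (x : Γ) • b - b := fun x ↦ rfl
  have hδ : ∀ x : P, (g - cb).1 x = g.1 x - ((x : Γ) • b - b) := fun x ↦ by
    rw [Submodule.coe_sub, ContinuousMap.sub_apply, hcb_apply]
  have hZσ₀ : σ₀ ∈ zeroSubgroup (g - cb) := by
    rw [mem_zeroSubgroup_iff, hδ, hgσ₀, sub_self]
  have hZU₀ : ∀ v : P, (v : Γ) ∈ U₀ → v ∈ zeroSubgroup (g - cb) := fun v hv ↦ by
    rw [mem_zeroSubgroup_iff, hδ, claim1 v hv, (hU₀mem _).1 hv b hbT, sub_self, sub_zero]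
  refine ⟨b, fun x ↦ ?_⟩
  obtain ⟨k, v, hv, hx⟩ := hgen x
  have hxZ : x ∈ zeroSubgroup (g - cb) := by
    rw [hx]
    exact (zeroSubgroup (g - cb)).mul_mem ((zeroSubgroup (g - cb)).zpow_mem hZσ₀ k) (hZU₀ v hv)
  rw [mem_zeroSubgroup_iff, hδ, sub_eq_zero] at hxZ
  exact hxZ

end Cocycle

end Summit.BirchSwinnertonDyer.Rank1Residual.X2.GreenbergVatsalProPrimeToPCocycle

end
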